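import Literature.NumberTheory.EllipticCurves.LeadingTermBSZReductionTypesProofs
import Literature.NumberTheory.EllipticCurves.PointCountHasseInvariantProofs
import Literature.NumberTheory.EllipticCurves.LFunctionSmulProofs
import Literature.NumberTheory.EllipticCurves.SupersingularDensity
import Literature.NumberTheory.Automorphic.LangWave0Proofs
import HarnessLib

/-!
# Bhargava–Skinner–Zhang, proof of Lemma 17: ordinarity of `E_{A,B}` at `p`, and `S₀(5) = {5 ∤ A}`

`Proofs` companion of `Literature/NumberTheory/EllipticCurves/LeadingTerm.lean` (bsd.S27,
`Literature.NumberTheory.EllipticCurves.bhargava_skinner_zhang`), continuing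
`LeadingTermBSZReductionTypesProofs.lean` (minimality and the reduction types of `E_{A,B}` at
`p ≥ 5`) and `LeadingTermBSZLocalDensityProofs.lean` (the density of `{5 ∤ A}`). Source:
M. Bhargava, C. Skinner, W. Zhang, *A majority of elliptic curves over `ℚ` satisfy the Birch and
Swinnerton-Dyer conjecture*, arXiv:1407.1826 (2014), §3.1 (`S₀(p)` := "the set of elliptic curves
`E_{A,B}` over `ℚ` such that `E_{A,B}` has good ordinary or multiplicative reduction at `p`") and
the proof of Lemma 17 (p. 8):

> "In this case [good reduction at `p`], the condition that `E_{A,B}` has ordinary reduction is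
> that `p` not divide the coefficient of `x^{p-1}` in `(x³+Ax+B)^{(p-1)/2}` [Sil]. … If `p = 5`,
> then these conditions together amount to `5 ∤ A`."

This file PROVES these two sentences:

* `BSZLemma17.intCast_frobeniusTrace_shortModel`, `BSZLemma17.dvd_frobeniusTrace_shortModel_iff`
  — for an odd prime `p ∤ Δ(A,B)`, the trace of Frobenius `a_p = p + 1 - #Ẽ_{A,B}(𝔽_p)` of the
  `ℤ`-model `[0, 0, 0, A, B]` (the tree's `Literature.NumberTheory.Automorphic.frobeniusTrace`)
  satisfies `a_p ≡ 4^{(p-1)/2} · [x^{p-1}] (x³+Ax+B)^{(p-1)/2} (mod p)`, hence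
  `p ∣ a_p ↔ [x^{p-1}] (x³+Ax+B)^{(p-1)/2} ≡ 0 (mod p)` — Silverman, *AEC* V.4.1(a)
  ("`a = A_q` as an equality in `𝔽_q`", `A_q` the coefficient of `x^{q-1}` in `Ψ₂²(x)^{(q-1)/2}`,
  `Ψ₂² = 4x³ + b₂x² + 2b₄x + b₆ = 4(x³ + Ax + B)` here), the tree's
  `WeierstrassCurve.cast_card_add_one_sub_natCard_point` (`PointCountHasseInvariantProofs`);
* `BSZLemma17.five_dvd_frobeniusTrace_shortModel_iff` — at `p = 5`, `[x⁴] (x³+Ax+B)² = 2A`, so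
  `5 ∣ a_5 ↔ 5 ∣ A` (for `5 ∤ 4A³ + 27B²`);
* `BSZLemma17.frobeniusTrace_eq_of_smul_eq_shortWeierstrass` — for ANY global minimal model `W`
  of `E_{A,B}` (`C • W = E_{A,B}`) and a prime `p ∤ Δ(A,B)`, the tree's `W.frobeniusTrace p`
  (computed on the global minimal model) equals the `a_p` of `[0, 0, 0, A, B]` (both are the `p`-th
  coefficient of the isomorphism-invariant `L`-function: `LFunction_apply_prime_eq_frobeniusTrace`,
  `LFunction_smul`, `lFunction_map_apply_prime_of_not_dvd` of the tree);
* `bsz_lemma17_mem_S0_five_iff` — **"these conditions together amount to `5 ∤ A`"**: for `(A, B)`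
  in the height family and any global minimal model `W` of `E_{A,B}`,
  `(good reduction at 5 ∧ 5 ∤ a_5) ∨ (multiplicative reduction at 5) ↔ 5 ∤ A`, in the
  prime-indexed vocabulary `HasGoodReductionAtPrime` / `frobeniusTrace` /
  `HasMultiplicativeReductionAtPrime` of bsd.S30 (`padicValRat_bsd_rank_zero`) in which hypothesis
  (a) of Theorems 5 and 9 of the source is phrased; `bsz_lemma17_mem_S0_five_iff'` is the same with
  the tree's `goodOrdinaryPrimes`. Together with `hasHeightDensity_not_five_dvd`
  (`LeadingTermBSZLocalDensityProofs`) this is Lemma 17 of the source in full: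
  `μ(S₀(5)) = μ({5 ∤ A}) = 4·5¹⁰/(5(5¹⁰-1))`.

No definitions and no named facts are introduced (D-0026).

## References

* M. Bhargava, C. Skinner, W. Zhang, arXiv:1407.1826 (2014), §3.1 and Lemma 17 (proof, p. 8).
  [cite: BhargavaSkinnerZhang2014, Lemma 17 (proof)]
* J. H. Silverman, *The Arithmetic of Elliptic Curves*, GTM 106, 2nd ed. (2009), Thm. V.4.1(a)
  and its proof (`#E(𝔽_q) = 1 - A_q`, "`a = A_q` as an equality in `𝔽_q`"); Exercise 8.19(a)
  (`c_p = t_p`). [cite: SilvermanAEC2009, V.4.1(a)]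
-/

open Polynomial IsDedekindDomain WeierstrassCurve Rat.HeightOneSpectrum

namespace Literature.NumberTheory.EllipticCurves

namespace BSZLemma17

/-! ### The Hasse coefficient of `y² = x³ + ax + b` -/

/-- For `y² = x³ + ax + b`: `Ψ₂²(x) = 4x³ + b₂x² + 2b₄x + b₆ = 4(x³ + ax + b)`. [folklore] -/
theorem twoTorsionPolynomial_toPoly_shortModel {R : Type*} [CommRing R] (a b : R) :
    (⟨0, 0, 0, a, b⟩ : WeierstrassCurve R).twoTorsionPolynomial.toPoly =
      C 4 * (X ^ 3 + C a * X + C b) := by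
  simp only [WeierstrassCurve.twoTorsionPolynomial, Cubic.toPoly, WeierstrassCurve.b₂,
    WeierstrassCurve.b₄, WeierstrassCurve.b₆, map_add, map_mul, map_pow, map_zero, map_ofNat]
  ring

/-- `[x⁴] (x³ + ax + b)² = 2a` (the Hasse coefficient at `p = 5`). [folklore] -/
theorem coeff_four_sq {R : Type*} [CommRing R] (a b : R) :
    ((X ^ 3 + C a * X + C b) ^ 2).coeff 4 = 2 * a := by
  have key : (X ^ 3 + C a * X + C b) ^ 2 = X ^ 6 + C (2 * a) * X ^ 4 + C (2 * b) * X ^ 3 +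
      C (a ^ 2) * X ^ 2 + C (2 * a * b) * X + C (b ^ 2) := by
    simp only [map_mul, map_pow, map_ofNat]; ring
  rw [key]
  simp only [coeff_add, coeff_X_pow, coeff_C_mul_X_pow, coeff_C_mul_X, coeff_C]
  norm_num

/-- The base change of the `ℤ`-model `[0, 0, 0, A, B]` along a ring map. [folklore] -/
theorem map_shortModel {R : Type*} [CommRing R] (f : ℤ →+* R) (A B : ℤ) :
    (⟨0, 0, 0, A, B⟩ : WeierstrassCurve ℤ).map f = ⟨0, 0, 0, f A, f B⟩ := by
  simp [WeierstrassCurve.map]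

/-! ### `a_p ≡ A_p (mod p)` for the `ℤ`-model `[0, 0, 0, A, B]` (Silverman V.4.1(a)) -/

/-- **`a_p(E_{A,B}) ≡ 4^{(p-1)/2} · [x^{p-1}] (x³+Ax+B)^{(p-1)/2} (mod p)`** for an odd prime
`p ∤ Δ(A,B)`, where `a_p = p + 1 - #Ẽ(𝔽_p)` is computed on the reduction of `[0, 0, 0, A, B]`
(`Literature.NumberTheory.Automorphic.frobeniusTrace`): Silverman's "`a = A_q` in `𝔽_q`" with
`Ψ₂² = 4(x³ + Ax + B)`. [cite: SilvermanAEC2009, V.4.1(a)] -/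
theorem intCast_frobeniusTrace_shortModel {p : ℕ} [hp : Fact p.Prime] (hp2 : p ≠ 2) (A B : ℤ)
    (hΔ : ¬ (p : ℤ) ∣ (⟨0, 0, 0, A, B⟩ : WeierstrassCurve ℤ).Δ) :
    ((Automorphic.frobeniusTrace ⟨0, 0, 0, A, B⟩ p : ℤ) : ZMod p) =
      4 ^ ((p - 1) / 2) *
        ((X ^ 3 + C (A : ZMod p) * X + C (B : ZMod p)) ^ ((p - 1) / 2)).coeff (p - 1) := by
  set E : WeierstrassCurve (ZMod p) :=
    (⟨0, 0, 0, A, B⟩ : WeierstrassCurve ℤ).map (Int.castRingHom (ZMod p)) with hE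
  haveI : E.IsElliptic := by
    rw [WeierstrassCurve.isElliptic_iff, hE, WeierstrassCurve.map_Δ, isUnit_iff_ne_zero, eq_intCast,
      ne_eq, ZMod.intCast_zmod_eq_zero_iff_dvd]
    exact hΔ
  have h2 : ringChar (ZMod p) ≠ 2 := by rw [ZMod.ringChar_zmod_n]; exact hp2
  have h := WeierstrassCurve.cast_card_add_one_sub_natCard_point E h2
  rw [ZMod.card] at h
  have hE' : E = ⟨0, 0, 0, (A : ZMod p), (B : ZMod p)⟩ := by
    rw [hE, map_shortModel]; simp
  rw [Automorphic.frobeniusTrace, Automorphic.numPointsMod, ← hE, h, hE',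
    twoTorsionPolynomial_toPoly_shortModel, mul_pow, ← C_pow, coeff_C_mul]

/-- `4 ≠ 0` modulo an odd prime. [folklore] -/
theorem four_ne_zero_zmod {p : ℕ} [hp : Fact p.Prime] (hp2 : p ≠ 2) : (4 : ZMod p) ≠ 0 := by
  have h2 : (2 : ZMod p) ≠ 0 := by
    intro h
    have h' : ((2 : ℕ) : ZMod p) = 0 := by exact_mod_cast h
    rw [ZMod.natCast_eq_zero_iff] at h'
    exact hp2 ((Nat.prime_dvd_prime_iff_eq hp.out Nat.prime_two).mp h')
  have : (4 : ZMod p) = 2 * 2 := by norm_num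
  rw [this]
  exact mul_ne_zero h2 h2

/-- **BSZ, proof of Lemma 17 / Silverman V.4.1(a): for an odd prime `p ∤ Δ(A,B)`, `p ∣ a_p(E_{A,B})`
(supersingular reduction) iff `p` divides the coefficient of `x^{p-1}` in `(x³+Ax+B)^{(p-1)/2}`**;
equivalently `E_{A,B}` is ordinary at `p` iff that coefficient is prime to `p`.
[cite: BhargavaSkinnerZhang2014, Lemma 17 (proof)] -/
theorem dvd_frobeniusTrace_shortModel_iff {p : ℕ} [hp : Fact p.Prime] (hp2 : p ≠ 2) (A B : ℤ)
    (hΔ : ¬ (p : ℤ) ∣ (⟨0, 0, 0, A, B⟩ : WeierstrassCurve ℤ).Δ) :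
    (p : ℤ) ∣ Automorphic.frobeniusTrace ⟨0, 0, 0, A, B⟩ p ↔
      ((X ^ 3 + C (A : ZMod p) * X + C (B : ZMod p)) ^ ((p - 1) / 2)).coeff (p - 1) = 0 := by
  rw [← ZMod.intCast_zmod_eq_zero_iff_dvd, intCast_frobeniusTrace_shortModel hp2 A B hΔ, mul_eq_zero,
    or_iff_right (pow_ne_zero _ (four_ne_zero_zmod hp2))]

/-- `Δ = -16(4A³ + 27B²)` of `[0, 0, 0, A, B]` is prime to `5` iff `4A³ + 27B²` is. [folklore] -/
theorem not_five_dvd_Δ_iff (A B : ℤ) :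
    ¬ (5 : ℤ) ∣ (⟨0, 0, 0, A, B⟩ : WeierstrassCurve ℤ).Δ ↔ ¬ (5 : ℤ) ∣ 4 * A ^ 3 + 27 * B ^ 2 := by
  rw [int_Δ]
  exact_mod_cast (dvd_Δ_iff Nat.prime_five le_rfl A B).not

/-- **At `p = 5`: `5 ∣ a_5(E_{A,B}) ↔ 5 ∣ A`** for `5 ∤ 4A³ + 27B²` (the coefficient of `x⁴` in
`(x³+Ax+B)²` is `2A`) — the ordinarity half of "these conditions together amount to `5 ∤ A`".
[cite: BhargavaSkinnerZhang2014, Lemma 17 (proof)] -/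
theorem five_dvd_frobeniusTrace_shortModel_iff (A B : ℤ) (hD : ¬ (5 : ℤ) ∣ 4 * A ^ 3 + 27 * B ^ 2) :
    (5 : ℤ) ∣ Automorphic.frobeniusTrace ⟨0, 0, 0, A, B⟩ 5 ↔ (5 : ℤ) ∣ A := by
  have h2 : (2 : ZMod 5) ≠ 0 := by decide
  haveI : Fact (Nat.Prime 5) := ⟨Nat.prime_five⟩
  have hΔ := (not_five_dvd_Δ_iff A B).mpr hD
  have h := dvd_frobeniusTrace_shortModel_iff (p := 5) (by norm_num) A B (by exact_mod_cast hΔ)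
  rw [show (5 - 1) / 2 = 2 from rfl, show 5 - 1 = 4 from rfl, coeff_four_sq, mul_eq_zero,
    or_iff_right h2, ZMod.intCast_zmod_eq_zero_iff_dvd] at h
  exact_mod_cast h

/-! ### From the `ℤ`-model to `E_{A,B} / ℚ` and its global minimal models -/

/-- The `p`-th coefficient of `L(E_{A,B}, s)` is the `a_p` of the `ℤ`-model `[0, 0, 0, A, B]` at a
prime `p ∤ Δ(A,B)` (the tree's `lFunction_map_apply_prime_of_not_dvd`). [folklore] -/
theorem lFunction_shortWeierstrass_eq_frobeniusTrace {AB : ℤ × ℤ} {p : ℕ} (hp : p.Prime)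
    (hΔ : ¬ (p : ℤ) ∣ (⟨0, 0, 0, AB.1, AB.2⟩ : WeierstrassCurve ℤ).Δ) :
    (shortWeierstrass AB).LFunction p = Automorphic.frobeniusTrace ⟨0, 0, 0, AB.1, AB.2⟩ p := by
  rw [shortWeierstrass_eq_baseChange, WeierstrassCurve.baseChange, algebraMap_int_eq]
  exact Automorphic.lFunction_map_apply_prime_of_not_dvd _ hp hΔ

/-- Good reduction is an isomorphism invariant, prime-indexed form over `ℚ` (from the tree's
place-indexed `hasGoodReductionAt_smul_iff_holds` and the bridge
`hasGoodReductionAtPrime_primesEquiv_iff_hasGoodReductionAt`). [cite: SilvermanAEC2009, VII.5 Prop. 5.1 and VII.1 Prop. 1.3(b)] -/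
theorem hasGoodReductionAtPrime_smul_iff (W : WeierstrassCurve ℚ) (C : VariableChange ℚ) (p : ℕ)
    [hp : Fact p.Prime] : (C • W).HasGoodReductionAtPrime p ↔ W.HasGoodReductionAtPrime p := by
  obtain ⟨v, rfl⟩ : ∃ v : HeightOneSpectrum ℤ, (primesEquiv v : ℕ) = p :=
    ⟨primesEquiv.symm ⟨p, hp.out⟩, by rw [Equiv.apply_symm_apply]⟩
  rw [hasGoodReductionAtPrime_primesEquiv_iff_hasGoodReductionAt,
    hasGoodReductionAtPrime_primesEquiv_iff_hasGoodReductionAt]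
  exact hasGoodReductionAt_smul_iff_holds v W C

/-- Multiplicative reduction is an isomorphism invariant for elliptic curves, prime-indexed form
over `ℚ` (from `hasMultiplicativeReductionAt_smul_iff_holds` and the bridge
`hasMultiplicativeReductionAtPrime_primesEquiv_iff_hasMultiplicativeReductionAt`).
[cite: SilvermanAEC2009, VII.5 Prop. 5.1 and VII.1 Prop. 1.3(b)] -/
theorem hasMultiplicativeReductionAtPrime_smul_iff (W : WeierstrassCurve ℚ) [W.IsElliptic]
    (C : VariableChange ℚ) (p : ℕ) [hp : Fact p.Prime] :
    (C • W).HasMultiplicativeReductionAtPrime p ↔ W.HasMultiplicativeReductionAtPrime p := by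
  obtain ⟨v, rfl⟩ : ∃ v : HeightOneSpectrum ℤ, (primesEquiv v : ℕ) = p :=
    ⟨primesEquiv.symm ⟨p, hp.out⟩, by rw [Equiv.apply_symm_apply]⟩
  rw [hasMultiplicativeReductionAtPrime_primesEquiv_iff_hasMultiplicativeReductionAt,
    hasMultiplicativeReductionAtPrime_primesEquiv_iff_hasMultiplicativeReductionAt]
  exact hasMultiplicativeReductionAt_smul_iff_holds v W C

/-- `E_{A,B}` has good reduction at every prime `p ∤ Δ(A,B) = -16(4A³+27B²)` (any `p`, any
`(A, B)`: the `ℤ`-model is then minimal at `p` with unit discriminant; Silverman VII.1 Rem. 1.1,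
VII.5 Prop. 5.1(a)). [cite: SilvermanAEC2009, VII.5 Prop. 5.1(a)] -/
theorem hasGoodReductionAtPrime_shortWeierstrass_of_not_dvd_Δ {AB : ℤ × ℤ} (p : ℕ)
    [hp : Fact p.Prime] (hΔ : ¬ (p : ℤ) ∣ (⟨0, 0, 0, AB.1, AB.2⟩ : WeierstrassCurve ℤ).Δ) :
    (shortWeierstrass AB).HasGoodReductionAtPrime p := by
  obtain ⟨v, rfl⟩ : ∃ v : HeightOneSpectrum ℤ, (primesEquiv v : ℕ) = p :=
    ⟨primesEquiv.symm ⟨p, hp.out⟩, by rw [Equiv.apply_symm_apply]⟩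
  rw [hasGoodReductionAtPrime_primesEquiv_iff_hasGoodReductionAt, shortWeierstrass_eq_baseChange]
  have hmin : ((⟨0, 0, 0, AB.1, AB.2⟩ : WeierstrassCurve ℤ).baseChange ℚ).IsMinimalAt v :=
    isMinimalAt_baseChange_int_of_not_pow_dvd_Δ fun h ↦ hΔ ((dvd_pow_self _ (by norm_num)).trans h)
  rw [hasGoodReductionAt_iff_of_isMinimalAt hmin, baseChange_int_Δ, Rat.valuation_intCast_eq_one_iff]
  exact hΔ

/-- **`a_p` of a global minimal model of `E_{A,B}` is the `a_p` of `[0, 0, 0, A, B]`** at a prime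
`p ∤ Δ(A,B)`: for `W / ℚ` globally minimal with `C • W = E_{A,B}`, the tree's `W.frobeniusTrace p`
(`p + 1 - #W̃(𝔽_p)` on the global minimal model) equals `p + 1 - #Ẽ_{A,B}(𝔽_p)`; both are the
`p`-th coefficient of the isomorphism-invariant `L(E, s)` (Silverman, *AEC* Ex. 8.19(a) and
Prop. VII.1.3(b): two `p`-minimal equations have isomorphic reductions).
[cite: SilvermanAEC2009, Exercise 8.19(a) with VII.1 Prop. 1.3(b)] -/
theorem frobeniusTrace_eq_of_smul_eq_shortWeierstrass {W : WeierstrassCurve ℚ} [W.IsElliptic]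
    [W.IsGloballyMinimal] {C : VariableChange ℚ} {AB : ℤ × ℤ} (h : C • W = shortWeierstrass AB)
    (p : ℕ) [hp : Fact p.Prime] (hΔ : ¬ (p : ℤ) ∣ (⟨0, 0, 0, AB.1, AB.2⟩ : WeierstrassCurve ℤ).Δ) :
    W.frobeniusTrace p = Automorphic.frobeniusTrace ⟨0, 0, 0, AB.1, AB.2⟩ p := by
  have hg : (shortWeierstrass AB).HasGoodReductionAtPrime p :=
    hasGoodReductionAtPrime_shortWeierstrass_of_not_dvd_Δ p hΔ
  have hgW : W.HasGoodReductionAtPrime p := by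
    rw [← hasGoodReductionAtPrime_smul_iff W C p, h]; exact hg
  rw [← LFunction_apply_prime_eq_frobeniusTrace W p hgW, ← LFunction_smul W C, h]
  exact lFunction_shortWeierstrass_eq_frobeniusTrace hp.out hΔ

end BSZLemma17

open BSZLemma17

/-! ### Lemma 17 of the source at `p = 5`: `S₀(5) = {E_{A,B} : 5 ∤ A}` -/

/-- **Bhargava–Skinner–Zhang, Lemma 17 (proof): "If `p = 5`, then these conditions together amount
to `5 ∤ A`."** For `(A, B)` in the height family and ANY global minimal model `W` of `E_{A,B}`
(`C • W = E_{A,B}`): `E_{A,B} ∈ S₀(5)`, i.e. `W` has good ordinary reduction at `5` (good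
reduction and `5 ∤ a_5`, the tree's `frobeniusTrace` of the global minimal model) or multiplicative
reduction at `5`, if and only if `5 ∤ A`. (Good at `5` iff `5 ∤ 4A³+27B²`, and then
`5 ∣ a_5 ↔ 5 ∣ 2A`; multiplicative at `5` iff `5 ∣ 4A³+27B²` and `5 ∤ A`.) With
`hasHeightDensity_not_five_dvd` (`LeadingTermBSZLocalDensityProofs`) this gives
`μ(S₀(5)) = 4·5¹⁰/(5(5¹⁰-1))`, Lemma 17 as printed. [cite: BhargavaSkinnerZhang2014, Lemma 17] -/
theorem bsz_lemma17_mem_S0_five_iff {W : WeierstrassCurve ℚ} [W.IsElliptic] [W.IsGloballyMinimal]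
    [Fact (Nat.Prime 5)] {C : VariableChange ℚ} {AB : ℤ × ℤ} (hfam : IsInHeightFamily AB)
    (h : C • W = shortWeierstrass AB) :
    (W.HasGoodReductionAtPrime 5 ∧ ¬ (5 : ℤ) ∣ W.frobeniusTrace 5) ∨
        W.HasMultiplicativeReductionAtPrime 5 ↔ ¬ (5 : ℤ) ∣ AB.1 := by
  have hg : W.HasGoodReductionAtPrime 5 ↔ ¬ (5 : ℤ) ∣ 4 * AB.1 ^ 3 + 27 * AB.2 ^ 2 := by
    rw [← hasGoodReductionAtPrime_smul_iff W C 5, h]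
    exact_mod_cast hasGoodReductionAtPrime_shortWeierstrass_iff_of_isInHeightFamily 5 hfam le_rfl
  have hm : W.HasMultiplicativeReductionAtPrime 5 ↔
      (5 : ℤ) ∣ 4 * AB.1 ^ 3 + 27 * AB.2 ^ 2 ∧ ¬ (5 : ℤ) ∣ AB.1 := by
    rw [← hasMultiplicativeReductionAtPrime_smul_iff W C 5, h]
    exact_mod_cast hasMultiplicativeReductionAtPrime_shortWeierstrass_iff_of_isInHeightFamily 5 hfam
      le_rfl
  by_cases hD : (5 : ℤ) ∣ 4 * AB.1 ^ 3 + 27 * AB.2 ^ 2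
  · rw [hm]
    constructor
    · rintro (⟨hgood, -⟩ | ⟨-, hA⟩)
      · exact absurd hD (hg.mp hgood)
      · exact hA
    · exact fun hA ↦ Or.inr ⟨hD, hA⟩
  · have hΔ : ¬ ((5 : ℕ) : ℤ) ∣ (⟨0, 0, 0, AB.1, AB.2⟩ : WeierstrassCurve ℤ).Δ := by
      exact_mod_cast (not_five_dvd_Δ_iff AB.1 AB.2).mpr hD
    have hord : (5 : ℤ) ∣ W.frobeniusTrace 5 ↔ (5 : ℤ) ∣ AB.1 := by
      rw [frobeniusTrace_eq_of_smul_eq_shortWeierstrass h 5 hΔ]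
      exact five_dvd_frobeniusTrace_shortModel_iff AB.1 AB.2 hD
    rw [hm, hord]
    constructor
    · rintro (⟨-, hA⟩ | ⟨-, hA⟩) <;> exact hA
    · exact fun hA ↦ Or.inl ⟨hg.mpr hD, hA⟩

/-- The same with the tree's `goodOrdinaryPrimes` (`SupersingularDensity.lean`):
`E_{A,B} ∈ S₀(5)` iff `5` is a good ordinary prime of `W` or `W` is multiplicative at `5`, iff
`5 ∤ A`. [cite: BhargavaSkinnerZhang2014, Lemma 17] -/
theorem bsz_lemma17_mem_S0_five_iff' {W : WeierstrassCurve ℚ} [W.IsElliptic] [W.IsGloballyMinimal]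
    [Fact (Nat.Prime 5)] {C : VariableChange ℚ} {AB : ℤ × ℤ} (hfam : IsInHeightFamily AB)
    (h : C • W = shortWeierstrass AB) :
    5 ∈ W.goodOrdinaryPrimes ∨ W.HasMultiplicativeReductionAtPrime 5 ↔ ¬ (5 : ℤ) ∣ AB.1 := by
  rw [← bsz_lemma17_mem_S0_five_iff hfam h]
  refine or_congr_left ⟨fun ⟨_, h'⟩ ↦ h', fun h' ↦ ⟨inferInstance, h'⟩⟩

/-- In particular, for `(A, B)` in the height family with `5 ∤ A` and `5 ∤ 4A³ + 27B²`, every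
global minimal model of `E_{A,B}` has good ordinary reduction at `5`: `5 ∤ a_5`.
[cite: BhargavaSkinnerZhang2014, Lemma 17 (proof)] -/
theorem not_five_dvd_frobeniusTrace_of_not_dvd {W : WeierstrassCurve ℚ} [W.IsElliptic]
    [W.IsGloballyMinimal] {C : VariableChange ℚ} {AB : ℤ × ℤ} (h : C • W = shortWeierstrass AB)
    (hA : ¬ (5 : ℤ) ∣ AB.1) (hD : ¬ (5 : ℤ) ∣ 4 * AB.1 ^ 3 + 27 * AB.2 ^ 2) :
    ¬ (5 : ℤ) ∣ W.frobeniusTrace 5 := by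
  haveI : Fact (Nat.Prime 5) := ⟨Nat.prime_five⟩
  have hΔ : ¬ ((5 : ℕ) : ℤ) ∣ (⟨0, 0, 0, AB.1, AB.2⟩ : WeierstrassCurve ℤ).Δ := by
    exact_mod_cast (not_five_dvd_Δ_iff AB.1 AB.2).mpr hD
  rw [frobeniusTrace_eq_of_smul_eq_shortWeierstrass h 5 hΔ, five_dvd_frobeniusTrace_shortModel_iff
    AB.1 AB.2 hD]
  exact hA

end Literature.NumberTheory.EllipticCurves
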